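import Summits.HodgeConjecture.HodgeConjecture.Theorems.HodgeLocusCensusSigmaFamilySmooth

/-!
# Hodge-locus census, cell family (10, d, 4) — THEOREM SM-∞ kernel-checked in full for k′ = 5:
# the explicit Σ°-member `N·F₀ + F₁` is non-singular for every degree `d ≥ 4` and every `N ≥ 2d − 1`

certified instances and evidence bearing on the general Hodge conjecture; no claim.

ENGINE B gen 35 (record `ENGINEB-g35.md` §1.7).  Same setting and proof as the anchor `HodgeLocusCensusSigmaFamilySmooth`
(k′ = 3, 4), imported for its rescaled block bounds `block_xy_scaled`, `block_ab_scaled` and the contradiction step `pert`: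
coordinates `a, b, x₀..x₄, y₀..y₄` on `ℙ¹¹`, `d = e + 3 ≥ 4`, `F₀ = Σ_j (y_j x_j^{e+2} + y_j^{e+3}) + a^{e+2} b + a b^{e+2}`,
Σ-coupling `F₁ = −y₀ x₁^{e+1} x₂ − y₁ x₂^{e+1} x₃ − y₂ x₃^{e+1} x₄ − y₃ x₀ x₄^{e+1} + a b x₀^{e} x₁`.  The twelve hypotheses of
`sigma_member_k5_nonsingular` are the partial derivatives of `F_N = N·F₀ + F₁` written as `N·(∂F₀) + (∂F₁)` monomial by
monomial; the conclusion: they do not all vanish at a non-zero point whenever `e ≥ 1` and `N ≥ 2e + 5` (real), i.e. `V(F_N) ⊂ ℙ¹¹`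
is SMOOTH for every `(d, N)` with `d ≥ 4`, `N ≥ 2d − 1`.  Transcription of the partials checked against implementation B's
polynomial gradient in exact arithmetic (`gen35/check_smooth_partials_k5.py`: 240 random Gaussian-integer points, d = 4..11,
0 mismatches).  Def-free; imports only the cell's anchor `HodgeLocusCensusSigmaFamilySmooth`.
-/

namespace Summit.HodgeConjecture.HodgeConjecture.HodgeLocus.Census.SigmaFamilySmoothK5

open Summit.HodgeConjecture.HodgeConjecture.HodgeLocus.Census.SigmaFamilySmooth

/-- THEOREM SM-∞, cell family `(10, e+3, 4)`: for `e ≥ 1`, real `N ≥ 2e + 5` and `(a,b,x₀,…,x₄,y₀,…,y₄) ≠ 0` the twelve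
partial derivatives of `F_N = N·F₀ + F₁` (the hypotheses' left-hand sides) do not vanish simultaneously: `V(F_N) ⊂ ℙ¹¹` is smooth. -/
theorem sigma_member_k5_nonsingular (e : ℕ) (he : 1 ≤ e) (N : ℝ) (hN : 2 * (e : ℝ) + 5 ≤ N)
    (a b x0 x1 x2 x3 x4 y0 y1 y2 y3 y4 : ℂ)
    (hne : ¬ (a = 0 ∧ b = 0 ∧ x0 = 0 ∧ x1 = 0 ∧ x2 = 0 ∧ x3 = 0 ∧ x4 = 0 ∧ y0 = 0 ∧ y1 = 0 ∧ y2 = 0 ∧ y3 = 0 ∧ y4 = 0)) :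
    ¬ ( (N : ℂ) * (b * (((e : ℂ) + 2) * a ^ (e + 1) + b ^ (e + 1))) + b * x0 ^ e * x1 = 0 ∧
        (N : ℂ) * (a * (a ^ (e + 1) + ((e : ℂ) + 2) * b ^ (e + 1))) + a * x0 ^ e * x1 = 0 ∧
        (N : ℂ) * (((e : ℂ) + 2) * x0 ^ (e + 1) * y0) + (-(y3 * x4 ^ (e + 1)) + (e : ℂ) * a * b * x0 ^ (e - 1) * x1) = 0 ∧
        (N : ℂ) * (((e : ℂ) + 2) * x1 ^ (e + 1) * y1) + (-(((e : ℂ) + 1) * y0 * x1 ^ e * x2) + a * b * x0 ^ e) = 0 ∧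
        (N : ℂ) * (((e : ℂ) + 2) * x2 ^ (e + 1) * y2) + (-(y0 * x1 ^ (e + 1)) - ((e : ℂ) + 1) * y1 * x2 ^ e * x3) = 0 ∧
        (N : ℂ) * (((e : ℂ) + 2) * x3 ^ (e + 1) * y3) + (-(y1 * x2 ^ (e + 1)) - ((e : ℂ) + 1) * y2 * x3 ^ e * x4) = 0 ∧
        (N : ℂ) * (((e : ℂ) + 2) * x4 ^ (e + 1) * y4) + (-(y2 * x3 ^ (e + 1)) - ((e : ℂ) + 1) * y3 * x0 * x4 ^ e) = 0 ∧
        (N : ℂ) * (x0 ^ (e + 2) + ((e : ℂ) + 3) * y0 ^ (e + 2)) + (-(x1 ^ (e + 1) * x2)) = 0 ∧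
        (N : ℂ) * (x1 ^ (e + 2) + ((e : ℂ) + 3) * y1 ^ (e + 2)) + (-(x2 ^ (e + 1) * x3)) = 0 ∧
        (N : ℂ) * (x2 ^ (e + 2) + ((e : ℂ) + 3) * y2 ^ (e + 2)) + (-(x3 ^ (e + 1) * x4)) = 0 ∧
        (N : ℂ) * (x3 ^ (e + 2) + ((e : ℂ) + 3) * y3 ^ (e + 2)) + (-(x0 * x4 ^ (e + 1))) = 0 ∧
        (N : ℂ) * (x4 ^ (e + 2) + ((e : ℂ) + 3) * y4 ^ (e + 2)) + 0 = 0 ) := by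
  rintro ⟨Ha, Hb, Hx0, Hx1, Hx2, Hx3, Hx4, Hy0, Hy1, Hy2, Hy3, Hy4⟩
  -- the sup norm m and the coordinate attaining it
  let v : Fin 12 → ℝ := ![‖a‖, ‖b‖, ‖x0‖, ‖x1‖, ‖x2‖, ‖x3‖, ‖x4‖, ‖y0‖, ‖y1‖, ‖y2‖, ‖y3‖, ‖y4‖]
  obtain ⟨i, -, hi⟩ := Finset.exists_max_image Finset.univ v Finset.univ_nonempty
  have hA : ‖a‖ ≤ v i := by simpa [v] using hi 0 (Finset.mem_univ _)
  have hB : ‖b‖ ≤ v i := by simpa [v] using hi 1 (Finset.mem_univ _)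
  have hX0 : ‖x0‖ ≤ v i := by simpa [v] using hi 2 (Finset.mem_univ _)
  have hX1 : ‖x1‖ ≤ v i := by simpa [v] using hi 3 (Finset.mem_univ _)
  have hX2 : ‖x2‖ ≤ v i := by simpa [v] using hi 4 (Finset.mem_univ _)
  have hX3 : ‖x3‖ ≤ v i := by simpa [v] using hi 5 (Finset.mem_univ _)
  have hX4 : ‖x4‖ ≤ v i := by simpa [v] using hi 6 (Finset.mem_univ _)
  have hY0 : ‖y0‖ ≤ v i := by simpa [v] using hi 7 (Finset.mem_univ _)
  have hY1 : ‖y1‖ ≤ v i := by simpa [v] using hi 8 (Finset.mem_univ _)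
  have hY2 : ‖y2‖ ≤ v i := by simpa [v] using hi 9 (Finset.mem_univ _)
  have hY3 : ‖y3‖ ≤ v i := by simpa [v] using hi 10 (Finset.mem_univ _)
  have hY4 : ‖y4‖ ≤ v i := by simpa [v] using hi 11 (Finset.mem_univ _)
  have hwhich : ‖a‖ = v i ∨ ‖b‖ = v i ∨ ‖x0‖ = v i ∨ ‖x1‖ = v i ∨ ‖x2‖ = v i ∨ ‖x3‖ = v i ∨
      ‖x4‖ = v i ∨ ‖y0‖ = v i ∨ ‖y1‖ = v i ∨ ‖y2‖ = v i ∨ ‖y3‖ = v i ∨ ‖y4‖ = v i := by fin_cases i <;> simp [v]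
  generalize v i = m at hA hB hX0 hX1 hX2 hX3 hX4 hY0 hY1 hY2 hY3 hY4 hwhich
  have hm : 0 < m := by
    by_contra hle
    have hle' : m ≤ 0 := not_lt.mp hle
    exact hne ⟨norm_le_zero_iff.mp (hA.trans hle'), norm_le_zero_iff.mp (hB.trans hle'), norm_le_zero_iff.mp (hX0.trans hle'), norm_le_zero_iff.mp (hX1.trans hle'), norm_le_zero_iff.mp (hX2.trans hle'), norm_le_zero_iff.mp (hX3.trans hle'), norm_le_zero_iff.mp (hX4.trans hle'), norm_le_zero_iff.mp (hY0.trans hle'), norm_le_zero_iff.mp (hY1.trans hle'), norm_le_zero_iff.mp (hY2.trans hle'), norm_le_zero_iff.mp (hY3.trans hle'), norm_le_zero_iff.mp (hY4.trans hle')⟩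
  -- numeric facts
  have heR : (0 : ℝ) ≤ (e : ℝ) := by positivity
  have hM : (0 : ℝ) ≤ (e : ℝ) + 2 := by linarith
  have hN' : 2 * ((e : ℝ) + 2) < N := by linarith
  have hc : (0 : ℝ) < m ^ (e + 2) := pow_pos hm _
  have hpow3 : m ^ (e + 2) = m * m * m ^ (e - 1) * m := by rw [show e + 2 = (e - 1) + 3 by omega]; ring
  have hne1 : ‖((e : ℂ) + 1)‖ = (e : ℝ) + 1 := by
    rw [show ((e : ℂ) + 1) = (((e + 1 : ℕ)) : ℂ) by push_cast; ring, Complex.norm_natCast, Nat.cast_add, Nat.cast_one]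
  -- coupling bounds ‖∂F₁‖ ≤ (e+2) m^{e+2}
  have ca : ‖b * x0 ^ e * x1‖ ≤ ((e : ℝ) + 2) * m ^ (e + 2) := by
    calc ‖b * x0 ^ e * x1‖ = ‖b‖ * ‖x0‖ ^ e * ‖x1‖ := by rw [norm_mul, norm_mul, norm_pow]
      _ ≤ m * m ^ e * m := by gcongr
      _ = 1 * m ^ (e + 2) := by ring
      _ ≤ ((e : ℝ) + 2) * m ^ (e + 2) := by gcongr; linarith
  have cb : ‖a * x0 ^ e * x1‖ ≤ ((e : ℝ) + 2) * m ^ (e + 2) := by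
    calc ‖a * x0 ^ e * x1‖ = ‖a‖ * ‖x0‖ ^ e * ‖x1‖ := by rw [norm_mul, norm_mul, norm_pow]
      _ ≤ m * m ^ e * m := by gcongr
      _ = 1 * m ^ (e + 2) := by ring
      _ ≤ ((e : ℝ) + 2) * m ^ (e + 2) := by gcongr; linarith
  have cx0 : ‖-(y3 * x4 ^ (e + 1)) + (e : ℂ) * a * b * x0 ^ (e - 1) * x1‖ ≤ ((e : ℝ) + 2) * m ^ (e + 2) := by
    have t1 : ‖-(y3 * x4 ^ (e + 1))‖ ≤ m ^ (e + 2) := by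
      calc ‖-(y3 * x4 ^ (e + 1))‖ = ‖y3‖ * ‖x4‖ ^ (e + 1) := by rw [norm_neg, norm_mul, norm_pow]
        _ ≤ m * m ^ (e + 1) := by gcongr
        _ = m ^ (e + 2) := by ring
    have t2 : ‖(e : ℂ) * a * b * x0 ^ (e - 1) * x1‖ ≤ (e : ℝ) * m ^ (e + 2) := by
      calc ‖(e : ℂ) * a * b * x0 ^ (e - 1) * x1‖ = (e : ℝ) * ‖a‖ * ‖b‖ * ‖x0‖ ^ (e - 1) * ‖x1‖ := by
            rw [norm_mul, norm_mul, norm_mul, norm_mul, norm_pow, Complex.norm_natCast]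
        _ ≤ (e : ℝ) * m * m * m ^ (e - 1) * m := by gcongr
        _ = (e : ℝ) * m ^ (e + 2) := by rw [hpow3]; ring
    calc _ ≤ ‖-(y3 * x4 ^ (e + 1))‖ + ‖(e : ℂ) * a * b * x0 ^ (e - 1) * x1‖ := norm_add_le _ _
      _ ≤ m ^ (e + 2) + (e : ℝ) * m ^ (e + 2) := add_le_add t1 t2
      _ ≤ ((e : ℝ) + 2) * m ^ (e + 2) := by nlinarith
  have cx1 : ‖-(((e : ℂ) + 1) * y0 * x1 ^ e * x2) + a * b * x0 ^ e‖ ≤ ((e : ℝ) + 2) * m ^ (e + 2) := by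
    have t1 : ‖-(((e : ℂ) + 1) * y0 * x1 ^ e * x2)‖ ≤ ((e : ℝ) + 1) * m ^ (e + 2) := by
      calc ‖-(((e : ℂ) + 1) * y0 * x1 ^ e * x2)‖ = ((e : ℝ) + 1) * ‖y0‖ * ‖x1‖ ^ e * ‖x2‖ := by
            rw [norm_neg, norm_mul, norm_mul, norm_mul, norm_pow, hne1]
        _ ≤ ((e : ℝ) + 1) * m * m ^ e * m := by gcongr
        _ = ((e : ℝ) + 1) * m ^ (e + 2) := by ring
    have t2 : ‖a * b * x0 ^ e‖ ≤ m ^ (e + 2) := by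
      calc ‖a * b * x0 ^ e‖ = ‖a‖ * ‖b‖ * ‖x0‖ ^ e := by rw [norm_mul, norm_mul, norm_pow]
        _ ≤ m * m * m ^ e := by gcongr
        _ = m ^ (e + 2) := by ring
    calc _ ≤ ‖-(((e : ℂ) + 1) * y0 * x1 ^ e * x2)‖ + ‖a * b * x0 ^ e‖ := norm_add_le _ _
      _ ≤ ((e : ℝ) + 1) * m ^ (e + 2) + m ^ (e + 2) := add_le_add t1 t2
      _ = ((e : ℝ) + 2) * m ^ (e + 2) := by ring
  have cx2 : ‖-(y0 * x1 ^ (e + 1)) - ((e : ℂ) + 1) * y1 * x2 ^ e * x3‖ ≤ ((e : ℝ) + 2) * m ^ (e + 2) := by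
    have t1 : ‖-(y0 * x1 ^ (e + 1))‖ ≤ m ^ (e + 2) := by
      calc ‖-(y0 * x1 ^ (e + 1))‖ = ‖y0‖ * ‖x1‖ ^ (e + 1) := by rw [norm_neg, norm_mul, norm_pow]
        _ ≤ m * m ^ (e + 1) := by gcongr
        _ = m ^ (e + 2) := by ring
    have t2 : ‖((e : ℂ) + 1) * y1 * x2 ^ e * x3‖ ≤ ((e : ℝ) + 1) * m ^ (e + 2) := by
      calc ‖((e : ℂ) + 1) * y1 * x2 ^ e * x3‖ = ((e : ℝ) + 1) * ‖y1‖ * ‖x2‖ ^ e * ‖x3‖ := by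
            rw [norm_mul, norm_mul, norm_mul, norm_pow, hne1]
        _ ≤ ((e : ℝ) + 1) * m * m ^ e * m := by gcongr
        _ = ((e : ℝ) + 1) * m ^ (e + 2) := by ring
    calc _ ≤ ‖-(y0 * x1 ^ (e + 1))‖ + ‖((e : ℂ) + 1) * y1 * x2 ^ e * x3‖ := norm_sub_le _ _
      _ ≤ m ^ (e + 2) + ((e : ℝ) + 1) * m ^ (e + 2) := add_le_add t1 t2
      _ = ((e : ℝ) + 2) * m ^ (e + 2) := by ring
  have cx3 : ‖-(y1 * x2 ^ (e + 1)) - ((e : ℂ) + 1) * y2 * x3 ^ e * x4‖ ≤ ((e : ℝ) + 2) * m ^ (e + 2) := by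
    have t1 : ‖-(y1 * x2 ^ (e + 1))‖ ≤ m ^ (e + 2) := by
      calc ‖-(y1 * x2 ^ (e + 1))‖ = ‖y1‖ * ‖x2‖ ^ (e + 1) := by rw [norm_neg, norm_mul, norm_pow]
        _ ≤ m * m ^ (e + 1) := by gcongr
        _ = m ^ (e + 2) := by ring
    have t2 : ‖((e : ℂ) + 1) * y2 * x3 ^ e * x4‖ ≤ ((e : ℝ) + 1) * m ^ (e + 2) := by
      calc ‖((e : ℂ) + 1) * y2 * x3 ^ e * x4‖ = ((e : ℝ) + 1) * ‖y2‖ * ‖x3‖ ^ e * ‖x4‖ := by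
            rw [norm_mul, norm_mul, norm_mul, norm_pow, hne1]
        _ ≤ ((e : ℝ) + 1) * m * m ^ e * m := by gcongr
        _ = ((e : ℝ) + 1) * m ^ (e + 2) := by ring
    calc _ ≤ ‖-(y1 * x2 ^ (e + 1))‖ + ‖((e : ℂ) + 1) * y2 * x3 ^ e * x4‖ := norm_sub_le _ _
      _ ≤ m ^ (e + 2) + ((e : ℝ) + 1) * m ^ (e + 2) := add_le_add t1 t2
      _ = ((e : ℝ) + 2) * m ^ (e + 2) := by ring
  have cx4 : ‖-(y2 * x3 ^ (e + 1)) - ((e : ℂ) + 1) * y3 * x0 * x4 ^ e‖ ≤ ((e : ℝ) + 2) * m ^ (e + 2) := by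
    have t1 : ‖-(y2 * x3 ^ (e + 1))‖ ≤ m ^ (e + 2) := by
      calc ‖-(y2 * x3 ^ (e + 1))‖ = ‖y2‖ * ‖x3‖ ^ (e + 1) := by rw [norm_neg, norm_mul, norm_pow]
        _ ≤ m * m ^ (e + 1) := by gcongr
        _ = m ^ (e + 2) := by ring
    have t2 : ‖((e : ℂ) + 1) * y3 * x0 * x4 ^ e‖ ≤ ((e : ℝ) + 1) * m ^ (e + 2) := by
      calc ‖((e : ℂ) + 1) * y3 * x0 * x4 ^ e‖ = ((e : ℝ) + 1) * ‖y3‖ * ‖x0‖ * ‖x4‖ ^ e := by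
            rw [norm_mul, norm_mul, norm_mul, norm_pow, hne1]
        _ ≤ ((e : ℝ) + 1) * m * m * m ^ e := by gcongr
        _ = ((e : ℝ) + 1) * m ^ (e + 2) := by ring
    calc _ ≤ ‖-(y2 * x3 ^ (e + 1))‖ + ‖((e : ℂ) + 1) * y3 * x0 * x4 ^ e‖ := norm_sub_le _ _
      _ ≤ m ^ (e + 2) + ((e : ℝ) + 1) * m ^ (e + 2) := add_le_add t1 t2
      _ = ((e : ℝ) + 2) * m ^ (e + 2) := by ring
  have cy0 : ‖-(x1 ^ (e + 1) * x2)‖ ≤ ((e : ℝ) + 2) * m ^ (e + 2) := by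
    calc ‖-(x1 ^ (e + 1) * x2)‖ = ‖x1‖ ^ (e + 1) * ‖x2‖ := by rw [norm_neg, norm_mul, norm_pow]
      _ ≤ m ^ (e + 1) * m := by gcongr
      _ = 1 * m ^ (e + 2) := by ring
      _ ≤ ((e : ℝ) + 2) * m ^ (e + 2) := by gcongr; linarith
  have cy1 : ‖-(x2 ^ (e + 1) * x3)‖ ≤ ((e : ℝ) + 2) * m ^ (e + 2) := by
    calc ‖-(x2 ^ (e + 1) * x3)‖ = ‖x2‖ ^ (e + 1) * ‖x3‖ := by rw [norm_neg, norm_mul, norm_pow]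
      _ ≤ m ^ (e + 1) * m := by gcongr
      _ = 1 * m ^ (e + 2) := by ring
      _ ≤ ((e : ℝ) + 2) * m ^ (e + 2) := by gcongr; linarith
  have cy2 : ‖-(x3 ^ (e + 1) * x4)‖ ≤ ((e : ℝ) + 2) * m ^ (e + 2) := by
    calc ‖-(x3 ^ (e + 1) * x4)‖ = ‖x3‖ ^ (e + 1) * ‖x4‖ := by rw [norm_neg, norm_mul, norm_pow]
      _ ≤ m ^ (e + 1) * m := by gcongr
      _ = 1 * m ^ (e + 2) := by ring
      _ ≤ ((e : ℝ) + 2) * m ^ (e + 2) := by gcongr; linarith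
  have cy3 : ‖-(x0 * x4 ^ (e + 1))‖ ≤ ((e : ℝ) + 2) * m ^ (e + 2) := by
    calc ‖-(x0 * x4 ^ (e + 1))‖ = ‖x0‖ * ‖x4‖ ^ (e + 1) := by rw [norm_neg, norm_mul, norm_pow]
      _ ≤ m * m ^ (e + 1) := by gcongr
      _ = 1 * m ^ (e + 2) := by ring
      _ ≤ ((e : ℝ) + 2) * m ^ (e + 2) := by gcongr; linarith
  have cy4 : ‖(0 : ℂ)‖ ≤ ((e : ℝ) + 2) * m ^ (e + 2) := by rw [norm_zero]; positivity
  -- which coordinate attains the sup norm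
  rcases hwhich with h1 | h1 | h1 | h1 | h1 | h1 | h1 | h1 | h1 | h1 | h1 | h1
  · rcases block_ab_scaled e he a b m hm hA hB (Or.inl h1) with h | h
    · exact pert N _ _ _ _ hc hM hN' h ca Ha
    · exact pert N _ _ _ _ hc hM hN' h cb Hb
  · rcases block_ab_scaled e he a b m hm hA hB (Or.inr h1) with h | h
    · exact pert N _ _ _ _ hc hM hN' h ca Ha
    · exact pert N _ _ _ _ hc hM hN' h cb Hb
  · rcases block_xy_scaled e he x0 y0 m hm hX0 hY0 (Or.inl h1) with h | h
    · exact pert N _ _ _ _ hc hM hN' h cx0 Hx0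
    · exact pert N _ _ _ _ hc hM hN' h cy0 Hy0
  · rcases block_xy_scaled e he x1 y1 m hm hX1 hY1 (Or.inl h1) with h | h
    · exact pert N _ _ _ _ hc hM hN' h cx1 Hx1
    · exact pert N _ _ _ _ hc hM hN' h cy1 Hy1
  · rcases block_xy_scaled e he x2 y2 m hm hX2 hY2 (Or.inl h1) with h | h
    · exact pert N _ _ _ _ hc hM hN' h cx2 Hx2
    · exact pert N _ _ _ _ hc hM hN' h cy2 Hy2
  · rcases block_xy_scaled e he x3 y3 m hm hX3 hY3 (Or.inl h1) with h | h
    · exact pert N _ _ _ _ hc hM hN' h cx3 Hx3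
    · exact pert N _ _ _ _ hc hM hN' h cy3 Hy3
  · rcases block_xy_scaled e he x4 y4 m hm hX4 hY4 (Or.inl h1) with h | h
    · exact pert N _ _ _ _ hc hM hN' h cx4 Hx4
    · exact pert N _ _ _ _ hc hM hN' h cy4 Hy4
  · rcases block_xy_scaled e he x0 y0 m hm hX0 hY0 (Or.inr h1) with h | h
    · exact pert N _ _ _ _ hc hM hN' h cx0 Hx0
    · exact pert N _ _ _ _ hc hM hN' h cy0 Hy0
  · rcases block_xy_scaled e he x1 y1 m hm hX1 hY1 (Or.inr h1) with h | h
    · exact pert N _ _ _ _ hc hM hN' h cx1 Hx1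
    · exact pert N _ _ _ _ hc hM hN' h cy1 Hy1
  · rcases block_xy_scaled e he x2 y2 m hm hX2 hY2 (Or.inr h1) with h | h
    · exact pert N _ _ _ _ hc hM hN' h cx2 Hx2
    · exact pert N _ _ _ _ hc hM hN' h cy2 Hy2
  · rcases block_xy_scaled e he x3 y3 m hm hX3 hY3 (Or.inr h1) with h | h
    · exact pert N _ _ _ _ hc hM hN' h cx3 Hx3
    · exact pert N _ _ _ _ hc hM hN' h cy3 Hy3
  · rcases block_xy_scaled e he x4 y4 m hm hX4 hY4 (Or.inr h1) with h | h
    · exact pert N _ _ _ _ hc hM hN' h cx4 Hx4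
    · exact pert N _ _ _ _ hc hM hN' h cy4 Hy4

end Summit.HodgeConjecture.HodgeConjecture.HodgeLocus.Census.SigmaFamilySmoothK5
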